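import Mathlib.RingTheory.Invariant.Basic
import Mathlib.RingTheory.TensorProduct.Basic
import Mathlib.LinearAlgebra.TensorProduct.Finiteness
import Mathlib.Algebra.Module.Projective
import Mathlib.RingTheory.Flat.Basic
import Mathlib.Algebra.Algebra.Pi
import HarnessLib

/-!
# Galois extensions of commutative rings: the Chase–Harrison–Rosenberg criterion

Let `G` be a finite group acting on a commutative ring `B` by automorphisms of an `A`-algebra
structure (`MulSemiringAction G B`, `SMulCommClass G A B`). The action is **free** (in the
scheme-theoretic sense: `G` acts freely on `Spec B`) when for every `g ≠ 1` the elements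
`g • b - b`, `b ∈ B`, generate the unit ideal — equivalently, for every `g ≠ 1` and every maximal
ideal `M ⊆ B` some `g • b - b ∉ M` (condition (iv) of Greither, *Cyclic Galois Extensions of
Commutative Rings*, LNM 1534, Ch. 0, Thm. 1.6 = Chase–Harrison–Rosenberg 1965, Thm. 1.3 (f)).
The theorem of Chase–Harrison–Rosenberg says that a free action with ring of invariants `A`
makes `B ⊇ A` a **`G`-Galois extension**: there are `x₁, …, xₙ, y₁, …, yₙ ∈ B` with
`∑ᵢ xᵢ · g(yᵢ) = δ_{g,1}` (condition (ii')), `B` is a finitely generated projective `A`-module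
(condition (iii)), and the canonical map `h : B ⊗_A B → B^{(G)} = Map(G, B)`,
`x ⊗ y ↦ (x · g(y))_g`, is bijective (condition (i), the definition of a Galois extension,
Greither Def. 1.5). Geometrically: `Spec B → Spec A = (Spec B)/G` is finite locally free and
`Spec B ×_{Spec A} Spec B ≅ G × Spec B`, i.e. `Spec B` is a `G`-torsor over `Spec A`.

This file **proves** these implications ((iv) ⇒ (ii') ⇒ (iii) and (i)), following the printed
proof of Greither, Thm. 1.6 (pp. 3–4), with one simplification in (iv) ⇒ (ii'): instead of
shuffling index sets we phrase (ii') as the existence of an element `e ∈ B ⊗_A B` with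
`μ₁(e) = 1` and `μ_g(e) = 0` for `g ≠ 1`, where `μ_g : B ⊗_A B → B`, `x ⊗ y ↦ x · g(y)`, is an
*algebra* homomorphism, so that the solutions for the individual `g ≠ 1` are combined by taking
their *product* in the ring `B ⊗_A B`. The bijectivity of `h` and its consequence for points
(the fibres of `Spec B → Spec A` are `G`-torsors) are in `ChaseHarrisonRosenbergTorsor`.

## Main statements

* `exists_sepElem_of_free`: (iv) ⇒ (ii') in the form `∃ e, μ₁ e = 1 ∧ ∀ g ≠ 1, μ_g e = 0`.
* `exists_finset_sum_mul_smul_of_free`: (ii') as printed, `∑ₚ xₚ · g(yₚ) = δ_{g,1}`.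
* `trace`: the `A`-linear trace `B → A`, `algebraMap (trace b) = ∑_g g • b` (needs `B^G = A`,
  i.e. `Algebra.IsInvariant A B G`, and `A → B` injective, i.e. `FaithfulSMul A B`).
* `finite_of_free`, `projective_of_free`: (iii), `B` is a finitely generated projective
  `A`-module (dual basis `(xᵢ, tr(- · yᵢ))`).
* (in the sequel `ChaseHarrisonRosenbergTorsor`: (i), `B ⊗_A B ≃ₐ[A] (G → B)`, and simple
  transitivity of `G` on the field-valued points of the fibres of `Spec B → Spec A`).

## References

* [Greither1992CyclicGalois] C. Greither, *Cyclic Galois Extensions of Commutative Rings*,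
  Lecture Notes in Mathematics 1534, Springer (1992), Ch. 0, §1: Def. 1.5, Thm. 1.6 (pp. 2–4),
  Lemma 1.9; held (galaxy panama:519141287002184, chunks 7–11 read 2026-08-15).
* [ChaseHarrisonRosenberg1965] S. U. Chase, D. K. Harrison, A. Rosenberg, *Galois theory and
  Galois cohomology of commutative rings*, Mem. Amer. Math. Soc. 52 (1965), 15–33, Thm. 1.3.

## Design

No new `Prop`-valued definitions: freeness is the explicit hypothesis
`hfree : ∀ g : G, g ≠ 1 → Ideal.span (Set.range fun b : B ↦ g • b - b) = ⊤`. The data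
definitions are `mulSMulHom A G g = μ_g`, `canonicalMap A G = h` (Mathlib
`Algebra.TensorProduct.lift`, `AlgHom.pi`) and `trace`. Mathlib has the invariant theory of finite group
actions (`Mathlib.RingTheory.Invariant.Basic`: integrality, transitivity on primes) and the
predicate `IsGaloisGroup`, but not Galois extensions of rings in the sense of
Auslander–Goldman / Chase–Harrison–Rosenberg (searched: `IsGalois`, `Galois extension`,
`separability idempotent`, `TensorProduct` + `MulSemiringAction`).
-/

noncomputable section

open scoped TensorProduct

namespace Literature.RingTheory.GaloisAlgebras

variable (A : Type*) {B : Type*} [CommRing A] [CommRing B] [Algebra A B]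
variable (G : Type*) [Group G] [MulSemiringAction G B] [SMulCommClass G A B]

/-! ### The algebra maps `μ_g : B ⊗_A B → B` and the canonical map `h` -/

/-- The `A`-algebra homomorphism `μ_g : B ⊗_A B → B`, `x ⊗ y ↦ x · g(y)` — the `g`-th component
of the canonical map `h` of Greither, *Cyclic Galois Extensions*, Ch. 0, Def. 1.3/1.5.
[cite: Greither1992CyclicGalois, Ch. 0 Def. 1.5 (p. 3)] -/
def mulSMulHom (g : G) : B ⊗[A] B →ₐ[A] B :=
  Algebra.TensorProduct.lift (AlgHom.id A B) (MulSemiringAction.toAlgHom A B g)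
    (fun _ _ ↦ Commute.all _ _)

/-- `μ_g (x ⊗ y) = x · g(y)` (Greither, Ch. 0, Def. 1.3). [folklore] -/
@[simp]
theorem mulSMulHom_tmul (g : G) (x y : B) : mulSMulHom A G g (x ⊗ₜ[A] y) = x * g • y := by
  simp [mulSMulHom, Algebra.TensorProduct.lift_tmul]

/-- The canonical map `h : B ⊗_A B → B^{(G)} = (G → B)`, `x ⊗ y ↦ (x · g(y))_{g ∈ G}`, an
`A`-algebra homomorphism; `B ⊇ A` is `G`-Galois iff `B^G = A` and `h` is bijective
(Greither, Ch. 0, Def. 1.5). [cite: Greither1992CyclicGalois, Ch. 0 Def. 1.5 (p. 3)] -/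
def canonicalMap : B ⊗[A] B →ₐ[A] (G → B) :=
  AlgHom.pi fun g ↦ mulSMulHom A G g

/-- The `g`-th component of the canonical map `h` is `μ_g`. [folklore] -/
@[simp]
theorem canonicalMap_apply (t : B ⊗[A] B) (g : G) :
    canonicalMap A G t g = mulSMulHom A G g t := rfl

/-- `h (x ⊗ y) = (x · g(y))_g` (Greither, Ch. 0, Def. 1.3/1.5). [folklore] -/
theorem canonicalMap_tmul (x y : B) (g : G) : canonicalMap A G (x ⊗ₜ[A] y) g = x * g • y := by
  simp

/-! ### (iv) ⇒ (ii'): free actions have a separability element -/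

/-- For a single `g`, every element of the ideal generated by the `g • b - b` is of the form
`μ_g t` with `μ₁ t = 0` (the set of such elements is an ideal containing the generators:
`t = 1 ⊗ b - b ⊗ 1`). First half of (iv) ⇒ (ii') in Greither, Ch. 0, Thm. 1.6.
[cite: Greither1992CyclicGalois, Ch. 0 Thm. 1.6 (pp. 3–4)] -/
theorem exists_mulSMulHom_eq_of_mem_span (g : G) {z : B}
    (hz : z ∈ Ideal.span (Set.range fun b : B ↦ g • b - b)) :
    ∃ t : B ⊗[A] B, mulSMulHom A G 1 t = 0 ∧ mulSMulHom A G g t = z := by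
  induction hz using Submodule.span_induction with
  | mem x hx =>
    obtain ⟨b, rfl⟩ := hx
    refine ⟨(1 : B) ⊗ₜ[A] b - b ⊗ₜ[A] 1, ?_, ?_⟩
    · simp
    · simp
  | zero => exact ⟨0, by simp, by simp⟩
  | add x y _ _ hx hy =>
    obtain ⟨t, ht₁, ht⟩ := hx
    obtain ⟨t', ht'₁, ht'⟩ := hy
    exact ⟨t + t', by simp [ht₁, ht'₁], by simp [ht, ht']⟩
  | smul a x _ hx =>
    obtain ⟨t, ht₁, ht⟩ := hx
    refine ⟨(a ⊗ₜ[A] (1 : B)) * t, ?_, ?_⟩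
    · rw [map_mul, ht₁, mul_zero]
    · rw [map_mul, ht, mulSMulHom_tmul, smul_one, mul_one, smul_eq_mul]

/-- **(iv) ⇒ (ii') (Chase–Harrison–Rosenberg).** If `G` acts freely — for every `g ≠ 1` the
elements `g • b - b` generate the unit ideal of `B` — then there is `e ∈ B ⊗_A B` with `μ₁(e) = 1`
and `μ_g(e) = 0` for all `g ≠ 1` (a preimage of `(1, 0, …, 0)` under `h`). For a single `g ≠ 1`
take `e_g = 1 - t` with `μ₁ t = 0`, `μ_g t = 1` (`exists_mulSMulHom_eq_of_mem_span`); then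
`e = ∏_{g ≠ 1} e_g`, the `μ`'s being ring homomorphisms (this replaces the index shuffling of
the printed proof, Greither, Ch. 0, Thm. 1.6, (iv) ⇒ (ii')).
[cite: Greither1992CyclicGalois, Ch. 0 Thm. 1.6 (pp. 3–4)] -/
theorem exists_sepElem_of_free [Finite G]
    (hfree : ∀ g : G, g ≠ 1 → Ideal.span (Set.range fun b : B ↦ g • b - b) = ⊤) :
    ∃ e : B ⊗[A] B, mulSMulHom A G 1 e = 1 ∧ ∀ g : G, g ≠ 1 → mulSMulHom A G g e = 0 := by
  classical
  let _ : Fintype G := Fintype.ofFinite G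
  -- a solution for each single `g ≠ 1`
  have hsingle : ∀ g : G, g ≠ 1 → ∃ e : B ⊗[A] B, mulSMulHom A G 1 e = 1 ∧ mulSMulHom A G g e = 0 := by
    intro g hg
    have h1 : (1 : B) ∈ Ideal.span (Set.range fun b : B ↦ g • b - b) := by
      rw [hfree g hg]; exact Submodule.mem_top
    obtain ⟨t, ht₁, ht⟩ := exists_mulSMulHom_eq_of_mem_span A G g h1
    exact ⟨1 - t, by simp [ht₁], by simp [ht]⟩
  choose! e he₁ he using hsingle
  refine ⟨∏ g ∈ Finset.univ.erase 1, e g, ?_, ?_⟩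
  · rw [map_prod]
    exact Finset.prod_eq_one fun g hg ↦ he₁ g (Finset.ne_of_mem_erase hg)
  · intro g hg
    rw [map_prod]
    exact Finset.prod_eq_zero (Finset.mem_erase.mpr ⟨hg, Finset.mem_univ g⟩) (he g hg)

include A in
/-- **Condition (ii') as printed**: for a free action there are finitely many pairs
`(x_p, y_p) ∈ B × B` with `∑ₚ x_p y_p = 1` and `∑ₚ x_p · g(y_p) = 0` for `g ≠ 1`
(Greither, Ch. 0, Thm. 1.6 (ii'); Chase–Harrison–Rosenberg, Thm. 1.3 (b)): write the element
`e` of `exists_sepElem_of_free` as a finite sum of pure tensors (over any base ring `A` for the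
`A`-algebra `B`, e.g. `A = B^G`). [cite: Greither1992CyclicGalois, Ch. 0 Thm. 1.6 (ii') (p. 3)] -/
theorem exists_finset_sum_mul_smul_of_free [Finite G]
    (hfree : ∀ g : G, g ≠ 1 → Ideal.span (Set.range fun b : B ↦ g • b - b) = ⊤) :
    ∃ s : Finset (B × B), (∑ p ∈ s, p.1 * p.2 = 1) ∧
      ∀ g : G, g ≠ 1 → ∑ p ∈ s, p.1 * g • p.2 = 0 := by
  obtain ⟨e, he₁, he⟩ := exists_sepElem_of_free A G hfree
  obtain ⟨s, rfl⟩ := TensorProduct.exists_finset e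
  refine ⟨s, ?_, fun g hg ↦ ?_⟩
  · simpa [map_sum] using he₁
  · simpa [map_sum] using he g hg

/-! ### Consequences of (ii'): the two orthogonality relations and the dual basis -/

section Families

variable {G}
variable {s : Finset (B × B)}

omit [SMulCommClass G A B] in
/-- The reversed orthogonality relation `∑ₚ g(x_p) · y_p = 0` for `g ≠ 1` (apply `g` to the
relation for `g⁻¹`; Greither, Ch. 0, proof of Thm. 1.6). [cite: Greither1992CyclicGalois, Ch. 0 Thm. 1.6 (pp. 3–4)] -/
theorem sum_smul_mul_eq_zero (hs : ∀ g : G, g ≠ 1 → ∑ p ∈ s, p.1 * g • p.2 = 0)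
    (g : G) (hg : g ≠ 1) : ∑ p ∈ s, g • p.1 * p.2 = 0 := by
  have h := congrArg (g • ·) (hs g⁻¹ (inv_ne_one.mpr hg))
  simp only [Finset.smul_sum, smul_mul', smul_smul, mul_inv_cancel, one_smul, smul_zero] at h
  exact h

variable [Fintype G]

omit [SMulCommClass G A B] in
/-- **Dual basis identity** `b = ∑ₚ tr(b · y_p) · x_p` with `tr = ∑_g g` (Greither, Ch. 0,
proof of Thm. 1.6, (ii') ⇒ (iii)): `∑ₚ ∑_g g(b) g(y_p) x_p = ∑_g g(b) δ_{g,1} = b`.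
[cite: Greither1992CyclicGalois, Ch. 0 Thm. 1.6, (ii') ⇒ (iii) (p. 4)] -/
theorem sum_sum_smul_mul_eq_self (hs₁ : ∑ p ∈ s, p.1 * p.2 = 1)
    (hs : ∀ g : G, g ≠ 1 → ∑ p ∈ s, p.1 * g • p.2 = 0) (b : B) :
    ∑ p ∈ s, (∑ g : G, g • (b * p.2)) * p.1 = b := by
  classical
  calc ∑ p ∈ s, (∑ g : G, g • (b * p.2)) * p.1
      = ∑ g : G, g • b * ∑ p ∈ s, p.1 * g • p.2 := by
        simp_rw [Finset.sum_mul, Finset.mul_sum, smul_mul']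
        rw [Finset.sum_comm]
        refine Finset.sum_congr rfl fun g _ ↦ Finset.sum_congr rfl fun p _ ↦ ?_
        ring
    _ = b := by
        rw [Fintype.sum_eq_single (1 : G) (fun g hg ↦ by rw [hs g hg, mul_zero])]
        simp_rw [one_smul]
        rw [hs₁, mul_one]

omit [SMulCommClass G A B] in
/-- The symmetric dual basis identity `b = ∑ₚ tr(b · x_p) · y_p` (from the reversed relations).
[cite: Greither1992CyclicGalois, Ch. 0 Thm. 1.6, (ii') ⇒ (iii) (p. 4)] -/
theorem sum_sum_smul_mul_eq_self' (hs₁ : ∑ p ∈ s, p.1 * p.2 = 1)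
    (hs : ∀ g : G, g ≠ 1 → ∑ p ∈ s, p.1 * g • p.2 = 0) (b : B) :
    ∑ p ∈ s, (∑ g : G, g • (b * p.1)) * p.2 = b := by
  classical
  calc ∑ p ∈ s, (∑ g : G, g • (b * p.1)) * p.2
      = ∑ g : G, g • b * ∑ p ∈ s, g • p.1 * p.2 := by
        simp_rw [Finset.sum_mul, Finset.mul_sum, smul_mul']
        rw [Finset.sum_comm]
        refine Finset.sum_congr rfl fun g _ ↦ Finset.sum_congr rfl fun p _ ↦ ?_
        ring
    _ = b := by
        rw [Fintype.sum_eq_single (1 : G) (fun g hg ↦ by rw [sum_smul_mul_eq_zero hs g hg,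
          mul_zero])]
        simp_rw [one_smul]
        rw [hs₁, mul_one]

end Families

/-! ### The trace `B → A` -/

section Trace

variable [Fintype G]

/-- `∑_g g • b` is `G`-invariant. [folklore] -/
theorem smul_sum_smul (h : G) (b : B) : h • ∑ g : G, g • b = ∑ g : G, g • b := by
  rw [Finset.smul_sum]
  simp_rw [smul_smul]
  exact Fintype.sum_equiv (Equiv.mulLeft h) _ _ fun _ ↦ rfl

variable [Algebra.IsInvariant A B G] [FaithfulSMul A B]

omit [SMulCommClass G A B] in
/-- With `B^G = A` (`Algebra.IsInvariant A B G`) and `A → B` injective, every `b` has a unique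
`a ∈ A` mapping to `∑_g g • b`. [folklore] -/
theorem existsUnique_algebraMap_eq_sum_smul (b : B) :
    ∃! a : A, algebraMap A B a = ∑ g : G, g • b := by
  obtain ⟨a, ha⟩ := Algebra.IsInvariant.isInvariant (A := A) (∑ g : G, g • b) (smul_sum_smul G · b)
  exact ⟨a, ha, fun a' ha' ↦ FaithfulSMul.algebraMap_injective A B (ha'.trans ha.symm)⟩

/-- **The trace** `tr : B → A` of a finite group action with ring of invariants `A`,
`tr(b) = ∑_{g ∈ G} g(b) ∈ B^G = A` (Greither, Ch. 0, proof of Thm. 1.6, (ii') ⇒ (iii): "tr is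
well-defined since `S^G = R`, and `R`-linear since all `σ ∈ G` are `R`-linear").
[cite: Greither1992CyclicGalois, Ch. 0 Thm. 1.6, (ii') ⇒ (iii) (p. 4)] -/
def trace : B →ₗ[A] A where
  toFun b := (existsUnique_algebraMap_eq_sum_smul A G b).exists.choose
  map_add' b b' := by
    apply FaithfulSMul.algebraMap_injective A B
    rw [(existsUnique_algebraMap_eq_sum_smul A G (b + b')).exists.choose_spec, map_add,
      (existsUnique_algebraMap_eq_sum_smul A G b).exists.choose_spec,
      (existsUnique_algebraMap_eq_sum_smul A G b').exists.choose_spec, ← Finset.sum_add_distrib]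
    simp_rw [smul_add]
  map_smul' a b := by
    apply FaithfulSMul.algebraMap_injective A B
    rw [(existsUnique_algebraMap_eq_sum_smul A G (a • b)).exists.choose_spec, RingHom.id_apply,
      smul_eq_mul, map_mul, (existsUnique_algebraMap_eq_sum_smul A G b).exists.choose_spec,
      Finset.mul_sum]
    refine Finset.sum_congr rfl fun g _ ↦ ?_
    rw [Algebra.smul_def, smul_mul', smul_algebraMap]

/-- Defining property of the trace: `algebraMap A B (tr b) = ∑_g g • b`. [folklore] -/
theorem algebraMap_trace (b : B) : algebraMap A B (trace A G b) = ∑ g : G, g • b :=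
  (existsUnique_algebraMap_eq_sum_smul A G b).exists.choose_spec

/-- `tr b • x = (∑_g g • b) * x`. [folklore] -/
theorem trace_smul (b x : B) : trace A G b • x = (∑ g : G, g • b) * x := by
  rw [Algebra.smul_def, algebraMap_trace]

end Trace

/-! ### (ii') ⇒ (iii): `B` is a finitely generated projective `A`-module -/

section Projective

variable [Fintype G] [Algebra.IsInvariant A B G] [FaithfulSMul A B]

/-- **`B` is finitely generated over `A`** for a free action with `B^G = A ⊆ B`: the `x_p`
generate, by the dual basis identity (Greither, Ch. 0, Thm. 1.6 (iii)).
[cite: Greither1992CyclicGalois, Ch. 0 Thm. 1.6 (iii) (pp. 3–4)] -/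
theorem finite_of_free
    (hfree : ∀ g : G, g ≠ 1 → Ideal.span (Set.range fun b : B ↦ g • b - b) = ⊤) :
    Module.Finite A B := by
  classical
  obtain ⟨s, hs₁, hs⟩ := exists_finset_sum_mul_smul_of_free A G hfree
  refine Module.Finite.of_surjective (Fintype.linearCombination A fun p : s ↦ (p : B × B).1) ?_
  intro b
  refine ⟨fun p ↦ trace A G (b * (p : B × B).2), ?_⟩
  rw [Fintype.linearCombination_apply]
  simp_rw [trace_smul]
  rw [Finset.sum_coe_sort s (fun p ↦ (∑ g : G, g • (b * p.2)) * p.1)]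
  exact sum_sum_smul_mul_eq_self hs₁ hs b

/-- **`B` is a projective `A`-module** for a free action with `B^G = A ⊆ B`: the pairs
`(x_p, tr(- · y_p))` form a dual basis, i.e. `b ↦ (tr(b y_p))_p`, `(a_p) ↦ ∑ a_p x_p` split `B`
off the free module `A^s` (Greither, Ch. 0, Thm. 1.6, (ii') ⇒ (iii); Chase–Harrison–Rosenberg,
Thm. 1.3). Hence `B` is flat over `A` (Greither, Lemma 1.9).
[cite: Greither1992CyclicGalois, Ch. 0 Thm. 1.6 (iii) (pp. 3–4)] -/
theorem projective_of_free
    (hfree : ∀ g : G, g ≠ 1 → Ideal.span (Set.range fun b : B ↦ g • b - b) = ⊤) :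
    Module.Projective A B := by
  classical
  obtain ⟨s, hs₁, hs⟩ := exists_finset_sum_mul_smul_of_free A G hfree
  let i : B →ₗ[A] (s → A) :=
    LinearMap.pi fun p : s ↦ trace A G ∘ₗ LinearMap.mulRight A (p : B × B).2
  let σ : (s → A) →ₗ[A] B := Fintype.linearCombination A fun p : s ↦ (p : B × B).1
  refine Module.Projective.of_split i σ ?_
  ext b
  simp only [LinearMap.coe_comp, Function.comp_apply, LinearMap.id_coe, id_eq, σ, i,
    Fintype.linearCombination_apply, LinearMap.pi_apply, LinearMap.mulRight_apply]
  simp_rw [trace_smul]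
  rw [Finset.sum_coe_sort s (fun p ↦ (∑ g : G, g • (b * p.2)) * p.1)]
  exact sum_sum_smul_mul_eq_self hs₁ hs b

/-- A free action with `B^G = A ⊆ B` makes `B` a flat `A`-module (Greither, Ch. 0, Lemma 1.9:
"flatness is clear since `S/R` is projective"). [cite: Greither1992CyclicGalois, Ch. 0 Lemma 1.9 (p. 5)] -/
theorem flat_of_free
    (hfree : ∀ g : G, g ≠ 1 → Ideal.span (Set.range fun b : B ↦ g • b - b) = ⊤) :
    Module.Flat A B :=
  have := projective_of_free A G (B := B) hfree
  inferInstance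

end Projective

end Literature.RingTheory.GaloisAlgebras
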